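import Literature.NumberTheory.Automorphic.LocalPiSchwartzBruhatFourier
import Literature.RepresentationTheory.HeisenbergGroup.SchrodingerConjugateTorusSphericalCoeff
import HarnessLib

/-!
# Box integrals of an additive character of the split form `(x, y) ↦ x ⬝ᵥ y` at a finite place

Topic `NumberTheory/Weil1965`; namespace `Literature.NumberTheory.Weil1965`. KERNEL MATHEMATICS ONLY: proved
theorems, no definition, no named fact, no `sorry`.

Let `F` be a non-archimedean local field, `κ` a finite index type, `μ` an additive Haar measure on `F`,
`μ^κ = Measure.pi μ` the product Haar measure on `F^κ = κ → F`, and `ψ : F → 𝕊` a continuous additive character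
(possibly trivial).  For a measurable `A ⊆ F^κ` of finite measure and a box `B = (𝔭^j)^κ` (a compact open subgroup)
the BOX INTEGRAL OF THE SPLIT FORM

  `J(A, B) = ∫_{A × B} ψ(x ⬝ᵥ y) d(μ^κ ⊗ μ^κ)(x, y)`

is computed by the orthogonality of characters on the compact group `B` («translation trick»):
`∫_B ψ(x ⬝ᵥ y) dy ∈ {0, μ^κ(B)}` according as `y ↦ ψ(x ⬝ᵥ y)` is trivial on `B` or not, whence

  `J(A, B) = μ^κ(A ∩ B^⊥_x) · μ^κ(B)`,  `B^⊥ = {x | ψ(x ⬝ᵥ y) = 1 ∀ y ∈ B}`  (closed),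

so `J(A, B)` is REAL, `0 ≤ J(A, B) ≤ μ^κ(A) μ^κ(B)`, monotone in `A`, and `J((𝔭^k)^κ, B) → 0` as `k → ∞`
(`μ^κ((𝔭^k)^κ) = (q^{-k} μ(𝒪))^{#κ} → 0`).  §1 is the translation trick for any compact open subgroup of a locally
compact abelian group; §2 the box integrals; §3 the same integrals with a scalar `η` (`ψ(η · x ⬝ᵥ y)`, i.e.
`ψ.mulShift η`, trivial when `η = 0`) and transported along a linear frame `β : F^ι ≃ F^κ × F^κ` with
`β_* μ^ι = c · μ^κ ⊗ μ^κ`.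

This is the local computation behind «`E_X` does not charge the coordinate hyperplanes of a split frame»
([Weil1965] n° 41 (35), n° 51), i.e. [WeilBNT1967] Chap. VII §2 Prop. 2 / Cor. 1 (Fourier transform of the
characteristic function of a lattice) read for the pairing `ψ(x ⬝ᵥ y)`.  USE (cell `hodgecm-mathlib`, P4 ENGINE E-2,
`StubSW2iii`, pole (S-3E) `Weil1965/AdelicSiegelMeasureFrameHyperplane`): the local factor `G_k(ξ)` of
`F*_{Φ_{k,j}}(ξ)`.  HC_CM is proved only modulo the printed citations until rung 0 closes.

## References
* [WeilBNT1967] A. Weil, *Basic Number Theory* (1967), Chap. II §5 Prop. 12; Chap. VII §2, Prop. 2, Cor. 1.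
* [Weil1965] A. Weil, *Sur la formule de Siegel dans la théorie des groupes classiques*, Acta Math. 113 (1965),
  Chap. IV n° 41 (35) p. 59; Chap. V n° 51 pp. 73–75.
-/

set_option autoImplicit false

noncomputable section

namespace Literature.NumberTheory.Weil1965

open _root_.MeasureTheory _root_.Filter _root_.Set Literature.NumberTheory.Automorphic
open Literature.NumberTheory.GaloisRepresentations.IsNonarchimedeanLocalField
open Literature.RepresentationTheory.HeisenbergGroup
open scoped Topology NNReal ENNReal

/-! ## §1 The translation trick: `∫_B χ ∈ {0, μ(B)}` for a character `χ` and a compact open subgroup `B` -/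

section TranslationTrick

variable {G : Type*} [AddCommGroup G] [TopologicalSpace G] [IsTopologicalAddGroup G] [MeasurableSpace G]
  [BorelSpace G] (μ : Measure G) [μ.IsAddLeftInvariant]

open scoped Classical in
/-- **Orthogonality on an open subgroup** («translation trick»): for an additive character `χ` of `G` (no continuity
needed) and an open subgroup `B` (for `μ(B) = ∞` both sides vanish by convention), `∫_B χ dμ = μ(B)` if `χ|_B = 1`
and `= 0` otherwise (translate by a `b ∈ B` with `χ b ≠ 1`). [cite: WeilBNT1967, Ch. VII §2, Prop. 2] -/
theorem setIntegral_coe_addChar_addSubgroup_eq_ite (B : AddSubgroup G) (hBo : IsOpen (B : Set G))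
    (χ : AddChar G Circle) :
    ∫ y in (B : Set G), ((χ y : Circle) : ℂ) ∂μ =
      if ∀ y ∈ B, χ y = 1 then ((μ.real (B : Set G) : ℝ) : ℂ) else 0 := by
  classical
  have hBm : MeasurableSet (B : Set G) := hBo.measurableSet
  by_cases htriv : ∀ y ∈ B, χ y = 1
  · rw [if_pos htriv]
    have h1 : ∫ y in (B : Set G), ((χ y : Circle) : ℂ) ∂μ = ∫ y in (B : Set G), (1 : ℂ) ∂μ :=
      setIntegral_congr_fun hBm fun y hy => by rw [htriv y hy, Circle.coe_one]
    rw [h1, setIntegral_const, Complex.real_smul, mul_one]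
  · rw [if_neg htriv]
    simp only [not_forall, exists_prop] at htriv
    obtain ⟨b, hb, hχb⟩ := htriv
    set I : ℂ := ∫ y in (B : Set G), ((χ y : Circle) : ℂ) ∂μ with hI
    -- translate by `b`: `I = χ b * I`
    have hmem : ∀ y : G, b + y ∈ (B : Set G) ↔ y ∈ (B : Set G) := fun y =>
      ⟨fun h => by simpa using B.sub_mem h hb, fun h => B.add_mem hb h⟩
    have hkey : I = ((χ b : Circle) : ℂ) * I := by
      rw [hI, ← integral_indicator hBm, ← integral_const_mul, ← integral_add_left_eq_self _ b]
      refine integral_congr_ae (Eventually.of_forall fun y => ?_)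
      simp only
      by_cases hy : y ∈ (B : Set G)
      · rw [indicator_of_mem ((hmem y).2 hy), indicator_of_mem hy, AddChar.map_add_eq_mul, Circle.coe_mul]
      · rw [indicator_of_notMem (fun h => hy ((hmem y).1 h)), indicator_of_notMem hy, mul_zero]
    have hne : (1 : ℂ) - ((χ b : Circle) : ℂ) ≠ 0 := fun h =>
      hχb (Circle.coe_eq_one.1 (sub_eq_zero.1 h).symm)
    have h0 : ((1 : ℂ) - ((χ b : Circle) : ℂ)) * I = 0 := by rw [sub_mul, one_mul, ← hkey, sub_self]
    exact (mul_eq_zero.1 h0).resolve_left hne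

end TranslationTrick

/-! ## §2 Box integrals of `ψ(x ⬝ᵥ y)` over `A × (𝔭^j)^κ` -/

section Box

variable {F : Type*} [Field F] [ValuativeRel F] [TopologicalSpace F] [IsNonarchimedeanLocalField F]
  {κ : Type*} [Fintype κ] [MeasurableSpace F] [BorelSpace F] (μ : Measure F) [μ.IsAddHaarMeasure]
  (ψ : AddChar F Circle)

omit [Fintype κ] [MeasurableSpace F] [BorelSpace F] in
/-- `F` is second countable (tree `secondCountableTopology_localField`, bound locally so that the Borel structures on
`F^κ`, `F^κ × F^κ` and the Haar property of `μ^κ` are found by instance search). [folklore] -/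
private theorem secondCountable : SecondCountableTopology F := secondCountableTopology_localField F

omit [ValuativeRel F] [TopologicalSpace F] [IsNonarchimedeanLocalField F] [MeasurableSpace F] [BorelSpace F] in
/-- the character `y ↦ ψ(x ⬝ᵥ y)` of `F^κ`. [cite: WeilBNT1967, Ch. II §5, Prop. 12] -/
private theorem exists_addChar_dotProduct (x : κ → F) :
    ∃ χ : AddChar (κ → F) Circle, ∀ y, χ y = ψ (x ⬝ᵥ y) :=
  ⟨{ toFun := fun y => ψ (x ⬝ᵥ y)
     map_zero_eq_one' := by simp only [dotProduct_zero, AddChar.map_zero_eq_one]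
     map_add_eq_mul' := fun a b => by simp only [dotProduct_add, AddChar.map_add_eq_mul] }, fun _ => rfl⟩

omit [MeasurableSpace F] [BorelSpace F] in
/-- The annihilator `{x | ψ(x ⬝ᵥ y) = 1 ∀ y ∈ B}` of a set `B` under the pairing `ψ(x ⬝ᵥ y)` is closed (`ψ`
continuous). [cite: WeilBNT1967, Ch. II §5, Prop. 12] -/
theorem isClosed_setOf_forall_addChar_dotProduct_eq_one (hψ : Continuous ψ) (B : Set (κ → F)) :
    IsClosed {x : κ → F | ∀ y ∈ B, ψ (x ⬝ᵥ y) = 1} := by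
  have : {x : κ → F | ∀ y ∈ B, ψ (x ⬝ᵥ y) = 1} = ⋂ y ∈ B, {x | ψ (x ⬝ᵥ y) = 1} := by
    ext x; simp only [mem_setOf_eq, mem_iInter]
  rw [this]
  exact isClosed_biInter fun y _ => isClosed_eq (hψ.comp (continuous_dotProduct_left y)) continuous_const

open scoped Classical in
/-- **Inner integral**: `∫_{(𝔭^j)^κ} ψ(x ⬝ᵥ y) dμ^κ(y) = μ^κ((𝔭^j)^κ)` if `ψ(x ⬝ᵥ ·)` is trivial on the box and
`= 0` otherwise. [cite: WeilBNT1967, Ch. VII §2, Prop. 2] -/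
theorem setIntegral_piPrimePowBall_coe_addChar_dotProduct_eq_ite (j : ℤ) (x : κ → F) :
    ∫ y in piPrimePowBall F κ j, ((ψ (x ⬝ᵥ y) : Circle) : ℂ) ∂(Measure.pi fun _ : κ => μ) =
      if ∀ y ∈ piPrimePowBall F κ j, ψ (x ⬝ᵥ y) = 1 then
        (((Measure.pi fun _ : κ => μ).real (piPrimePowBall F κ j) : ℝ) : ℂ) else 0 := by
  classical
  haveI : SecondCountableTopology F := secondCountable
  obtain ⟨χ, hχ⟩ := exists_addChar_dotProduct (κ := κ) ψ x
  let B : AddSubgroup (κ → F) :=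
    { carrier := piPrimePowBall F κ j
      add_mem' := fun ha hb => add_mem_piPrimePowBall ha hb
      zero_mem' := zero_mem_piPrimePowBall j
      neg_mem' := fun ha => neg_mem_piPrimePowBall ha }
  have hBc : (B : Set (κ → F)) = piPrimePowBall F κ j := rfl
  have h := setIntegral_coe_addChar_addSubgroup_eq_ite (Measure.pi fun _ : κ => μ) B
    (by rw [hBc]; exact isOpen_piPrimePowBall j) χ
  simp only [hBc, hχ] at h
  rw [h]
  rfl

/-- The integrand `1_{A × B}(x, y) ψ(x ⬝ᵥ y)` is integrable for the product Haar measure when `A`, `B` are measurable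
of finite measure (it is bounded by `1_{A × B}`). [cite: WeilBNT1967, Ch. VII §2, Prop. 2] -/
theorem integrableOn_coe_addChar_dotProduct_prod (hψ : Continuous ψ) {A B : Set (κ → F)}
    (hAμ : (Measure.pi fun _ : κ => μ) A ≠ ∞) (hBμ : (Measure.pi fun _ : κ => μ) B ≠ ∞) :
    IntegrableOn (fun p : (κ → F) × (κ → F) => ((ψ (p.1 ⬝ᵥ p.2) : Circle) : ℂ)) (A ×ˢ B)
      ((Measure.pi fun _ : κ => μ).prod (Measure.pi fun _ : κ => μ)) := by
  haveI : SecondCountableTopology F := secondCountable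
  refine Measure.integrableOn_of_bounded (M := 1) ?_ ?_ (Eventually.of_forall fun p => (Circle.norm_coe _).le)
  · rw [Measure.prod_prod]; exact ENNReal.mul_ne_top hAμ hBμ
  · exact (continuous_subtype_val.comp (hψ.comp
      ((continuous_fst).dotProduct continuous_snd))).aestronglyMeasurable

/-- **The box integral of the split form**: for a measurable `A ⊆ F^κ` of finite measure and a box `B = (𝔭^j)^κ`,
`∫_{A × B} ψ(x ⬝ᵥ y) d(μ^κ ⊗ μ^κ) = μ^κ(A ∩ B^⊥) · μ^κ(B)` with `B^⊥ = {x | ψ(x ⬝ᵥ y) = 1 ∀ y ∈ B}` — in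
particular a nonnegative real number. [cite: WeilBNT1967, Ch. VII §2, Prop. 2] -/
theorem setIntegral_prod_coe_addChar_dotProduct_eq (hψ : Continuous ψ) {A : Set (κ → F)} (hA : MeasurableSet A)
    (hAμ : (Measure.pi fun _ : κ => μ) A ≠ ∞) (j : ℤ) :
    ∫ p in A ×ˢ piPrimePowBall F κ j, ((ψ (p.1 ⬝ᵥ p.2) : Circle) : ℂ)
        ∂((Measure.pi fun _ : κ => μ).prod (Measure.pi fun _ : κ => μ)) =
      (((Measure.pi fun _ : κ => μ).real (A ∩ {x | ∀ y ∈ piPrimePowBall F κ j, ψ (x ⬝ᵥ y) = 1}) *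
          (Measure.pi fun _ : κ => μ).real (piPrimePowBall F κ j) : ℝ) : ℂ) := by
  classical
  haveI : SecondCountableTopology F := secondCountable
  set T : Set (κ → F) := {x | ∀ y ∈ piPrimePowBall F κ j, ψ (x ⬝ᵥ y) = 1} with hT
  have hTm : MeasurableSet T := (isClosed_setOf_forall_addChar_dotProduct_eq_one ψ hψ _).measurableSet
  rw [setIntegral_prod _ (integrableOn_coe_addChar_dotProduct_prod μ ψ hψ hAμ
    (measure_piPrimePowBall_lt_top _ j).ne)]
  have h1 : ∫ x in A, ∫ y in piPrimePowBall F κ j, ((ψ ((x, y).1 ⬝ᵥ (x, y).2) : Circle) : ℂ)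
        ∂(Measure.pi fun _ : κ => μ) ∂(Measure.pi fun _ : κ => μ) =
      ∫ x in A, T.indicator (fun _ => (((Measure.pi fun _ : κ => μ).real (piPrimePowBall F κ j) : ℝ) : ℂ)) x
        ∂(Measure.pi fun _ : κ => μ) := by
    refine setIntegral_congr_fun hA fun x _ => ?_
    simp only
    rw [setIntegral_piPrimePowBall_coe_addChar_dotProduct_eq_ite μ ψ j x]
    by_cases hx : x ∈ T
    · rw [indicator_of_mem hx, if_pos (show ∀ y ∈ piPrimePowBall F κ j, ψ (x ⬝ᵥ y) = 1 from hx)]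
    · rw [indicator_of_notMem hx, if_neg (show ¬ ∀ y ∈ piPrimePowBall F κ j, ψ (x ⬝ᵥ y) = 1 from hx)]
  rw [h1, setIntegral_indicator hTm, setIntegral_const, Complex.real_smul, Complex.ofReal_mul]

/-- **The box integral is real and nonnegative**. [cite: WeilBNT1967, Ch. VII §2, Prop. 2] -/
theorem setIntegral_prod_coe_addChar_dotProduct_nonneg (hψ : Continuous ψ) {A : Set (κ → F)}
    (hA : MeasurableSet A) (hAμ : (Measure.pi fun _ : κ => μ) A ≠ ∞) (j : ℤ) :
    0 ≤ (∫ p in A ×ˢ piPrimePowBall F κ j, ((ψ (p.1 ⬝ᵥ p.2) : Circle) : ℂ)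
        ∂((Measure.pi fun _ : κ => μ).prod (Measure.pi fun _ : κ => μ))).re ∧
      (∫ p in A ×ˢ piPrimePowBall F κ j, ((ψ (p.1 ⬝ᵥ p.2) : Circle) : ℂ)
        ∂((Measure.pi fun _ : κ => μ).prod (Measure.pi fun _ : κ => μ))).im = 0 := by
  rw [setIntegral_prod_coe_addChar_dotProduct_eq μ ψ hψ hA hAμ j, Complex.ofReal_re, Complex.ofReal_im]
  exact ⟨mul_nonneg measureReal_nonneg measureReal_nonneg, rfl⟩

/-- **Bound**: `‖∫_{A × B} ψ(x ⬝ᵥ y)‖ ≤ μ^κ(A) μ^κ(B)`. [cite: WeilBNT1967, Ch. VII §2, Prop. 2] -/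
theorem norm_setIntegral_prod_coe_addChar_dotProduct_le (hψ : Continuous ψ) {A : Set (κ → F)}
    (hA : MeasurableSet A) (hAμ : (Measure.pi fun _ : κ => μ) A ≠ ∞) (j : ℤ) :
    ‖∫ p in A ×ˢ piPrimePowBall F κ j, ((ψ (p.1 ⬝ᵥ p.2) : Circle) : ℂ)
        ∂((Measure.pi fun _ : κ => μ).prod (Measure.pi fun _ : κ => μ))‖ ≤
      (Measure.pi fun _ : κ => μ).real A * (Measure.pi fun _ : κ => μ).real (piPrimePowBall F κ j) := by
  rw [setIntegral_prod_coe_addChar_dotProduct_eq μ ψ hψ hA hAμ j, Complex.norm_real, Real.norm_eq_abs,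
    abs_of_nonneg (mul_nonneg measureReal_nonneg measureReal_nonneg)]
  exact mul_le_mul_of_nonneg_right (measureReal_mono inter_subset_left hAμ) measureReal_nonneg

/-- **Monotonicity in `A`**: for `A ⊆ A'` the box integrals satisfy `‖J(A, B)‖ ≤ ‖J(A', B)‖` (both are the
nonnegative reals `μ^κ(· ∩ B^⊥) μ^κ(B)`). [cite: WeilBNT1967, Ch. VII §2, Prop. 2] -/
theorem norm_setIntegral_prod_coe_addChar_dotProduct_mono (hψ : Continuous ψ) {A A' : Set (κ → F)}
    (hA : MeasurableSet A) (hA' : MeasurableSet A') (hAA' : A ⊆ A') (hA'μ : (Measure.pi fun _ : κ => μ) A' ≠ ∞)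
    (j : ℤ) :
    ‖∫ p in A ×ˢ piPrimePowBall F κ j, ((ψ (p.1 ⬝ᵥ p.2) : Circle) : ℂ)
        ∂((Measure.pi fun _ : κ => μ).prod (Measure.pi fun _ : κ => μ))‖ ≤
      ‖∫ p in A' ×ˢ piPrimePowBall F κ j, ((ψ (p.1 ⬝ᵥ p.2) : Circle) : ℂ)
        ∂((Measure.pi fun _ : κ => μ).prod (Measure.pi fun _ : κ => μ))‖ := by
  have hAμ : (Measure.pi fun _ : κ => μ) A ≠ ∞ := (measure_mono hAA').trans_lt hA'μ.lt_top |>.ne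
  rw [setIntegral_prod_coe_addChar_dotProduct_eq μ ψ hψ hA hAμ j,
    setIntegral_prod_coe_addChar_dotProduct_eq μ ψ hψ hA' hA'μ j, Complex.norm_real, Complex.norm_real,
    Real.norm_eq_abs, Real.norm_eq_abs, abs_of_nonneg (mul_nonneg measureReal_nonneg measureReal_nonneg),
    abs_of_nonneg (mul_nonneg measureReal_nonneg measureReal_nonneg)]
  refine mul_le_mul_of_nonneg_right (measureReal_mono (inter_subset_inter_left _ hAA') ?_) measureReal_nonneg
  exact ((measure_mono inter_subset_left).trans_lt hA'μ.lt_top).ne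

/-- `μ^κ((𝔭^k)^κ) → 0` as `k → ∞` (for `κ` nonempty: `μ^κ((𝔭^k)^κ) = (q^{#κ})^{-k} μ^κ(𝒪^κ)`).
[cite: WeilBNT1967, Ch. II §2, Prop. 4] -/
theorem tendsto_measureReal_piPrimePowBall_pi [Nonempty κ] :
    Tendsto (fun k : ℕ => (Measure.pi fun _ : κ => μ).real (piPrimePowBall F κ (k : ℤ))) atTop (𝓝 0) := by
  haveI : SecondCountableTopology F := secondCountable
  have hq1 : 1 < (residueFieldCard F : ℝ) := by exact_mod_cast one_lt_residueFieldCard F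
  have hcard : 0 < Fintype.card κ := Fintype.card_pos
  set r : ℝ := ((residueFieldCard F : ℝ) ^ Fintype.card κ)⁻¹ with hr
  have hr0 : 0 ≤ r := inv_nonneg.2 (pow_nonneg (zero_le_one.trans hq1.le) _)
  have hr1 : r < 1 := inv_lt_one_of_one_lt₀ (one_lt_pow₀ hq1 hcard.ne')
  have heq : ∀ k : ℕ, (Measure.pi fun _ : κ => μ).real (piPrimePowBall F κ (k : ℤ)) =
      r ^ k * (Measure.pi fun _ : κ => μ).real (piPrimePowBall F κ 0) := fun k => by
    rw [measureReal_piPrimePowBall_pi_eq_zpow_mul μ (k : ℤ), zpow_natCast]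
  simp only [heq]
  rw [← zero_mul ((Measure.pi fun _ : κ => μ).real (piPrimePowBall F κ 0))]
  exact (tendsto_pow_atTop_nhds_zero_of_lt_one hr0 hr1).mul_const _

/-- **The box integrals over `(𝔭^k)^κ × (𝔭^j)^κ` tend to `0` as `k → ∞`** (they are dominated by
`μ^κ((𝔭^k)^κ) μ^κ((𝔭^j)^κ)`). [cite: WeilBNT1967, Ch. VII §2, Prop. 2] -/
theorem tendsto_setIntegral_prod_coe_addChar_dotProduct [Nonempty κ] (hψ : Continuous ψ) (j : ℤ) :
    Tendsto (fun k : ℕ => ∫ p in piPrimePowBall F κ (k : ℤ) ×ˢ piPrimePowBall F κ j,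
        ((ψ (p.1 ⬝ᵥ p.2) : Circle) : ℂ) ∂((Measure.pi fun _ : κ => μ).prod (Measure.pi fun _ : κ => μ)))
      atTop (𝓝 0) := by
  haveI : SecondCountableTopology F := secondCountable
  rw [tendsto_zero_iff_norm_tendsto_zero]
  refine squeeze_zero (fun _ => norm_nonneg _)
    (fun k => norm_setIntegral_prod_coe_addChar_dotProduct_le μ ψ hψ (measurableSet_piPrimePowBall (k : ℤ))
      (measure_piPrimePowBall_lt_top _ (k : ℤ)).ne j) ?_
  rw [← zero_mul ((Measure.pi fun _ : κ => μ).real (piPrimePowBall F κ j))]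
  exact (tendsto_measureReal_piPrimePowBall_pi μ).mul_const _

end Box

/-! ## §3 With a scalar `η` and along a linear frame `β : F^ι ≃ F^κ × F^κ` -/

section Frame

variable {F : Type*} [Field F] [ValuativeRel F] [TopologicalSpace F] [IsNonarchimedeanLocalField F]
  {κ : Type*} [Fintype κ] {ι : Type*} [Fintype ι] [MeasurableSpace F] [BorelSpace F] (μ : Measure F)
  [μ.IsAddHaarMeasure] (ψ : AddChar F Circle)

omit [Fintype κ] [MeasurableSpace F] [BorelSpace F] in
/-- `t ↦ ψ(η t)` (`= ψ.mulShift η`) is continuous with `ψ`. [cite: WeilBNT1967, Ch. II §5, Prop. 12] -/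
theorem continuous_mulShift (hψ : Continuous ψ) (η : F) : Continuous (ψ.mulShift η) := by
  have : ((ψ.mulShift η : AddChar F Circle) : F → Circle) = fun t => ψ (η * t) := funext fun t => AddChar.mulShift_apply
  rw [this]
  exact hψ.comp (continuous_const.mul continuous_id)

omit [μ.IsAddHaarMeasure] in
/-- **Transport along a frame**: for a linear frame `β : F^ι ≃ F^κ × F^κ` with `β_* μ^ι = c · (μ^κ ⊗ μ^κ)` the `μ^ι`-integral
of `1_{β⁻¹(A × B)}(a) · ψ(η · (β a)₁ ⬝ᵥ (β a)₂)` is `c` times the box integral of `ψ(η · x ⬝ᵥ y)` over `A × B`.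
[cite: WeilBNT1967, Ch. VII §2, Prop. 2] -/
theorem integral_indicator_preimage_frame_mul_coe_addChar_eq (hψ : Continuous ψ)
    (β : (ι → F) ≃ₗ[F] ((κ → F) × (κ → F))) {c : ℝ≥0}
    (hHaar : Measure.map β (Measure.pi fun _ : ι => μ) =
      (c : ℝ≥0∞) • ((Measure.pi fun _ : κ => μ).prod (Measure.pi fun _ : κ => μ)))
    (η : F) {A B : Set (κ → F)} (hA : MeasurableSet A) (hB : MeasurableSet B) :
    ∫ a, (β ⁻¹' (A ×ˢ B)).indicator (fun _ => (1 : ℂ)) a * ((ψ (η * ((β a).1 ⬝ᵥ (β a).2)) : Circle) : ℂ)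
        ∂(Measure.pi fun _ : ι => μ) =
      (c : ℂ) * ∫ p in A ×ˢ B, ((ψ.mulShift η (p.1 ⬝ᵥ p.2) : Circle) : ℂ)
        ∂((Measure.pi fun _ : κ => μ).prod (Measure.pi fun _ : κ => μ)) := by
  classical
  haveI : SecondCountableTopology F := secondCountable
  have hβc : Continuous β := (β : (ι → F) →ₗ[F] ((κ → F) × (κ → F))).continuous_on_pi
  set g : (κ → F) × (κ → F) → ℂ := fun p => (A ×ˢ B).indicator (fun _ => (1 : ℂ)) p *
    ((ψ.mulShift η (p.1 ⬝ᵥ p.2) : Circle) : ℂ) with hg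
  have hAB : MeasurableSet (A ×ˢ B) := hA.prod hB
  have hgm : AEStronglyMeasurable g (Measure.map β (Measure.pi fun _ : ι => μ)) := by
    refine (Measurable.aestronglyMeasurable ?_)
    refine ((measurable_const.indicator hAB).mul ?_)
    exact (continuous_subtype_val.comp ((continuous_mulShift ψ hψ η).comp
      (continuous_fst.dotProduct continuous_snd))).measurable
  have h1 : (fun a => (β ⁻¹' (A ×ˢ B)).indicator (fun _ => (1 : ℂ)) a *
      ((ψ (η * ((β a).1 ⬝ᵥ (β a).2)) : Circle) : ℂ)) = fun a => g (β a) := by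
    funext a
    simp only [hg, AddChar.mulShift_apply]
    rfl
  have h3 : ∫ p, g p ∂((Measure.pi fun _ : κ => μ).prod (Measure.pi fun _ : κ => μ)) =
      ∫ p in A ×ˢ B, ((ψ.mulShift η (p.1 ⬝ᵥ p.2) : Circle) : ℂ)
        ∂((Measure.pi fun _ : κ => μ).prod (Measure.pi fun _ : κ => μ)) := by
    rw [← integral_indicator hAB]
    refine integral_congr_ae (Eventually.of_forall fun p => ?_)
    simp only [hg]
    by_cases hp : p ∈ A ×ˢ B
    · rw [indicator_of_mem hp, indicator_of_mem hp, one_mul]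
    · rw [indicator_of_notMem hp, indicator_of_notMem hp, zero_mul]
  rw [h1, ← integral_map hβc.measurable.aemeasurable hgm, hHaar, integral_smul_measure, ENNReal.coe_toReal, h3,
    Complex.real_smul]

open scoped Classical in
/-- **Frame form of the box integral formula**: with `B = (𝔭^j)^κ` and `A` measurable of finite measure,
`∫ 1_{β⁻¹(A × B)}(a) ψ(η (β a)₁ ⬝ᵥ (β a)₂) dμ^ι(a) = c · μ^κ(A ∩ B^⊥_η) · μ^κ(B)`,
`B^⊥_η = {x | ψ(η · x ⬝ᵥ y) = 1 ∀ y ∈ B}` — a nonnegative real number. [cite: WeilBNT1967, Ch. VII §2, Prop. 2] -/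
theorem integral_indicator_preimage_frame_mul_coe_addChar_eq_ofReal (hψ : Continuous ψ)
    (β : (ι → F) ≃ₗ[F] ((κ → F) × (κ → F))) {c : ℝ≥0}
    (hHaar : Measure.map β (Measure.pi fun _ : ι => μ) =
      (c : ℝ≥0∞) • ((Measure.pi fun _ : κ => μ).prod (Measure.pi fun _ : κ => μ)))
    (η : F) {A : Set (κ → F)} (hA : MeasurableSet A) (hAμ : (Measure.pi fun _ : κ => μ) A ≠ ∞) (j : ℤ) :
    ∫ a, (β ⁻¹' (A ×ˢ piPrimePowBall F κ j)).indicator (fun _ => (1 : ℂ)) a *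
        ((ψ (η * ((β a).1 ⬝ᵥ (β a).2)) : Circle) : ℂ) ∂(Measure.pi fun _ : ι => μ) =
      (((c : ℝ) * ((Measure.pi fun _ : κ => μ).real (A ∩ {x | ∀ y ∈ piPrimePowBall F κ j, ψ (η * (x ⬝ᵥ y)) = 1}) *
          (Measure.pi fun _ : κ => μ).real (piPrimePowBall F κ j)) : ℝ) : ℂ) := by
  haveI : SecondCountableTopology F := secondCountable
  rw [integral_indicator_preimage_frame_mul_coe_addChar_eq μ ψ hψ β hHaar η hA (measurableSet_piPrimePowBall j),
    setIntegral_prod_coe_addChar_dotProduct_eq μ (ψ.mulShift η) (continuous_mulShift ψ hψ η) hA hAμ j]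
  simp only [AddChar.mulShift_apply]
  push_cast
  ring

/-- **Frame form, bound**: `‖∫ 1_{β⁻¹(A × (𝔭^j)^κ)} ψ(η (β a)₁ ⬝ᵥ (β a)₂) dμ^ι‖ ≤ c · μ^κ(A) · μ^κ((𝔭^j)^κ)`.
[cite: WeilBNT1967, Ch. VII §2, Prop. 2] -/
theorem norm_integral_indicator_preimage_frame_mul_coe_addChar_le (hψ : Continuous ψ)
    (β : (ι → F) ≃ₗ[F] ((κ → F) × (κ → F))) {c : ℝ≥0}
    (hHaar : Measure.map β (Measure.pi fun _ : ι => μ) =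
      (c : ℝ≥0∞) • ((Measure.pi fun _ : κ => μ).prod (Measure.pi fun _ : κ => μ)))
    (η : F) {A : Set (κ → F)} (hA : MeasurableSet A) (hAμ : (Measure.pi fun _ : κ => μ) A ≠ ∞) (j : ℤ) :
    ‖∫ a, (β ⁻¹' (A ×ˢ piPrimePowBall F κ j)).indicator (fun _ => (1 : ℂ)) a *
        ((ψ (η * ((β a).1 ⬝ᵥ (β a).2)) : Circle) : ℂ) ∂(Measure.pi fun _ : ι => μ)‖ ≤
      (c : ℝ) * ((Measure.pi fun _ : κ => μ).real A * (Measure.pi fun _ : κ => μ).real (piPrimePowBall F κ j)) := by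
  haveI : SecondCountableTopology F := secondCountable
  rw [integral_indicator_preimage_frame_mul_coe_addChar_eq μ ψ hψ β hHaar η hA (measurableSet_piPrimePowBall j),
    norm_mul, Complex.norm_real, Real.norm_eq_abs, NNReal.abs_eq]
  refine mul_le_mul_of_nonneg_left ?_ c.coe_nonneg
  have h := norm_setIntegral_prod_coe_addChar_dotProduct_le μ (ψ.mulShift η) (continuous_mulShift ψ hψ η) hA hAμ j
  simp only [AddChar.mulShift_apply] at h
  exact h

/-- **Frame form, monotonicity in `A`** (`A ⊆ A'`): the norms of the frame integrals increase with `A` — the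
DOMINATION `‖G_k(ξ)‖ ≤ ‖G_0(ξ)‖` of the local factors of `F*_{Φ_{k,j}}(ξ)`. [cite: WeilBNT1967, Ch. VII §2, Prop. 2] -/
theorem norm_integral_indicator_preimage_frame_mul_coe_addChar_mono (hψ : Continuous ψ)
    (β : (ι → F) ≃ₗ[F] ((κ → F) × (κ → F))) {c : ℝ≥0}
    (hHaar : Measure.map β (Measure.pi fun _ : ι => μ) =
      (c : ℝ≥0∞) • ((Measure.pi fun _ : κ => μ).prod (Measure.pi fun _ : κ => μ)))
    (η : F) {A A' : Set (κ → F)} (hA : MeasurableSet A) (hA' : MeasurableSet A') (hAA' : A ⊆ A')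
    (hA'μ : (Measure.pi fun _ : κ => μ) A' ≠ ∞) (j : ℤ) :
    ‖∫ a, (β ⁻¹' (A ×ˢ piPrimePowBall F κ j)).indicator (fun _ => (1 : ℂ)) a *
        ((ψ (η * ((β a).1 ⬝ᵥ (β a).2)) : Circle) : ℂ) ∂(Measure.pi fun _ : ι => μ)‖ ≤
      ‖∫ a, (β ⁻¹' (A' ×ˢ piPrimePowBall F κ j)).indicator (fun _ => (1 : ℂ)) a *
        ((ψ (η * ((β a).1 ⬝ᵥ (β a).2)) : Circle) : ℂ) ∂(Measure.pi fun _ : ι => μ)‖ := by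
  haveI : SecondCountableTopology F := secondCountable
  rw [integral_indicator_preimage_frame_mul_coe_addChar_eq μ ψ hψ β hHaar η hA (measurableSet_piPrimePowBall j),
    integral_indicator_preimage_frame_mul_coe_addChar_eq μ ψ hψ β hHaar η hA' (measurableSet_piPrimePowBall j),
    norm_mul, norm_mul]
  refine mul_le_mul_of_nonneg_left ?_ (norm_nonneg _)
  have h := norm_setIntegral_prod_coe_addChar_dotProduct_mono μ (ψ.mulShift η) (continuous_mulShift ψ hψ η) hA hA'
    hAA' hA'μ j
  simp only [AddChar.mulShift_apply] at h
  exact h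

/-- **Frame form, limit**: the frame integrals over `β⁻¹((𝔭^k)^κ × (𝔭^j)^κ)` tend to `0` as `k → ∞` (for every `η`,
including `η = 0`) — the local factors `G_k(ξ) → 0`. [cite: WeilBNT1967, Ch. VII §2, Prop. 2] -/
theorem tendsto_integral_indicator_preimage_frame_mul_coe_addChar [Nonempty κ] (hψ : Continuous ψ)
    (β : (ι → F) ≃ₗ[F] ((κ → F) × (κ → F))) {c : ℝ≥0}
    (hHaar : Measure.map β (Measure.pi fun _ : ι => μ) =
      (c : ℝ≥0∞) • ((Measure.pi fun _ : κ => μ).prod (Measure.pi fun _ : κ => μ)))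
    (η : F) (j : ℤ) :
    Tendsto (fun k : ℕ => ∫ a, (β ⁻¹' (piPrimePowBall F κ (k : ℤ) ×ˢ piPrimePowBall F κ j)).indicator
        (fun _ => (1 : ℂ)) a * ((ψ (η * ((β a).1 ⬝ᵥ (β a).2)) : Circle) : ℂ) ∂(Measure.pi fun _ : ι => μ))
      atTop (𝓝 0) := by
  haveI : SecondCountableTopology F := secondCountable
  have h : ∀ k : ℕ, ∫ a, (β ⁻¹' (piPrimePowBall F κ (k : ℤ) ×ˢ piPrimePowBall F κ j)).indicator
        (fun _ => (1 : ℂ)) a * ((ψ (η * ((β a).1 ⬝ᵥ (β a).2)) : Circle) : ℂ) ∂(Measure.pi fun _ : ι => μ) =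
      (c : ℂ) * ∫ p in piPrimePowBall F κ (k : ℤ) ×ˢ piPrimePowBall F κ j,
        ((ψ.mulShift η (p.1 ⬝ᵥ p.2) : Circle) : ℂ) ∂((Measure.pi fun _ : κ => μ).prod (Measure.pi fun _ : κ => μ)) :=
    fun k => integral_indicator_preimage_frame_mul_coe_addChar_eq μ ψ hψ β hHaar η (measurableSet_piPrimePowBall _)
      (measurableSet_piPrimePowBall j)
  simp only [h]
  rw [← mul_zero (c : ℂ)]
  exact (tendsto_setIntegral_prod_coe_addChar_dotProduct μ (ψ.mulShift η) (continuous_mulShift ψ hψ η) j).const_mul _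


end Frame

end Literature.NumberTheory.Weil1965

end
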